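import Mathlib.Algebra.Category.ModuleCat.Ext.DimensionShifting
import Mathlib.Algebra.Homology.DerivedCategory.Ext.ExactSequences
import Mathlib.LinearAlgebra.FreeModule.PID
import Mathlib.RingTheory.Localization.Finiteness
import Mathlib.RingTheory.Support
import Summits.ResolutionOfSingularities.ResolutionOfSingularities.Theorems.HomologicalConductorNoZenoReflexiveSyzygy
import Summits.ResolutionOfSingularities.ResolutionOfSingularities.Theorems.HomologicalConductorNoZenoNormalDepthTwo
import Summits.ResolutionOfSingularities.ResolutionOfSingularities.Theorems.HomologicalConductorNoZenoHighSyzygyDual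
import Literature.AlgebraicGeometry.Resolution.DivisorialPlace
import HarnessLib

/-!
# CA2: `Ext¹_T(X, T) = 0` for reflexive `X` with `X* ∈ ΩCM` over a two-dimensional normal local domain

`[OURS · L W4.4 ∩ W4.4b]` Crux `HomologicalConductor.NoZenoR` (stmt-ResolutionOfSingularities-19943),
line `sandwich-cluster`, S3 Layer 2 CA-layer, target **CA2** `ext_one_eq_zero_of_dual_syzygy_of_reflexive`
of res-L0-w44-plan-1's CRUX-PLAN v5 §A (= [Iyama–Wemyss, *The classification of special Cohen–Macaulay
modules*, Math. Z. 265 (2010), Thm. 2.7 (e)⇒(d)] WITHOUT completeness), in the exact consumer shape of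
res-D-pv-037's (W)-rider `exists_extVanishingInput_dual_of_isSyzygy` (`…NoZenoHighSyzygyDual.lean`);
second consumer: rung S-2 `PersistenceSurface` (stmt-ResolutionOfSingularities-19970), programme M-rat,
hypothesis (IW-p). Replaces the role of no printed item of the manuscript under review; pure commutative
algebra; AI-written (weaker than expert review).

## Statement and proof

`T` noetherian local normal domain with `ringKrullDim T = 2`; `X` finitely generated reflexive; a short
exact `0 → X* → P → Y → 0` with `P` finitely generated free and `Y` finitely generated reflexive. Then
`Ext¹_T(X, T) = 0`.

Dualise: `0 → Y* → P* → X** ≅ X`; put `B := im(P* → X**)`, `E₁ := X**/B`. Then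
* `Ext¹(B, T) = 0`: dimension shifting along `0 → Y* → P* → B → 0` (`P*` projective) writes every class
  as the image of some `φ ∈ Y** = Hom(Y*, T)`; `Y` reflexive and `P ↠ Y` give `φ = ev_p ∘ π*`, which
  comes from `Hom(P*, T)`, so its image vanishes (`extClass_comp_assoc`);
* `Ext¹(E₁, T) = 0`: `E₁` is supported on `{𝔪}` — at a prime `𝔭 ≠ 𝔪` (height `≤ 1`, so `T_𝔭` is a
  field or a DVR by `(R₁)`, tree `isDiscreteValuationRing_localization_of_height_eq_one`) the torsion-free
  `Y` is free at `𝔭` (`exists_injective_forall_smul_mem_range`), so every functional on `X* = ker π`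
  extends to `P` after scaling by some `s ∉ 𝔭` (`exists_dual_comp_kerSubtype_eq_smul`), i.e.
  `s · X** ⊆ B`; then grade `≥ 2` (`subsingleton_ext_of_support_subset`, depth of a normal surface
  point, file `…NoZenoNormalDepthTwo.lean`) kills `Ext¹(E₁, T)`;
* the contravariant long exact sequence of `0 → B → X** → E₁ → 0` gives `Ext¹(X**, T) = 0`, and
  `X ≅ X**`.
[cite: IyamaWemyss2009, Thm. 2.7; folklore]
-/

-- single-problem summit: the doubled namespace component `ResolutionOfSingularities` is forced
set_option linter.dupNamespace false

noncomputable section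

open Module Function CategoryTheory Abelian IsLocalRing

universe u v w

namespace Summit.ResolutionOfSingularities.ResolutionOfSingularities.Theorems.NoZeno.SandwichCluster

/-! ## 1. Splitting after scaling (any commutative ring) -/

section SplitAfterScaling

variable {T : Type u} [CommRing T]
variable {F : Type v} [AddCommGroup F] [Module T F] {Y : Type w} [AddCommGroup Y] [Module T Y]
variable {G : Type*} [AddCommGroup G] [Module T G] [Module.Free T G]

/-- **Retraction after scaling.** If `π : F ↠ Y` is surjective and `Y` is "free up to `s`" — there is an
injective `β : G ↪ Y` from a free module with `s • Y ⊆ im β` — then `ker π ↪ F` admits a retraction up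
to `s`: a linear `ρ : F → ker π` with `ρ|_{ker π} = s • id`. [folklore] -/
theorem exists_linearMap_comp_kerSubtype_eq_smul (π : F →ₗ[T] Y) (hπ : Surjective π)
    (β : G →ₗ[T] Y) (hβ : Injective β) (s : T) (hs : ∀ y, s • y ∈ LinearMap.range β) :
    ∃ ρ : F →ₗ[T] LinearMap.ker π, ρ ∘ₗ (LinearMap.ker π).subtype = s • LinearMap.id := by
  classical
  let b := Module.Free.chooseBasis T G
  -- a lift `γ : G → F` of `β` along `π`
  let γ : G →ₗ[T] F := b.constr T fun i => Classical.choose (hπ (β (b i)))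
  have hγ : π ∘ₗ γ = β := by
    refine b.ext fun i => ?_
    simp only [LinearMap.coe_comp, Function.comp_apply, γ, Module.Basis.constr_basis]
    exact Classical.choose_spec (hπ (β (b i)))
  -- `θ : F → G` with `β ∘ θ = s • π`
  let e := LinearEquiv.ofInjective β hβ
  let θ : F →ₗ[T] G :=
    e.symm.toLinearMap ∘ₗ LinearMap.codRestrict (LinearMap.range β) (s • π) fun f => hs (π f)
  have hθ : ∀ f, β (θ f) = s • π f := by
    intro f
    have : (e (θ f) : Y) = s • π f := by
      simp only [θ, LinearMap.coe_comp, LinearEquiv.coe_coe, Function.comp_apply,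
        LinearEquiv.apply_symm_apply, LinearMap.codRestrict_apply, LinearMap.smul_apply]
    simpa [e, LinearEquiv.ofInjective_apply] using this
  -- `ρ₀ := s • id - γ ∘ θ` lands in `ker π`
  let ρ₀ : F →ₗ[T] F := s • LinearMap.id - γ ∘ₗ θ
  have hρ₀ : ∀ f, ρ₀ f ∈ LinearMap.ker π := by
    intro f
    rw [LinearMap.mem_ker]
    have h1 : π (γ (θ f)) = β (θ f) := LinearMap.congr_fun hγ (θ f)
    simp only [ρ₀, LinearMap.sub_apply, LinearMap.smul_apply, LinearMap.id_apply, LinearMap.coe_comp,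
      Function.comp_apply, map_sub, map_smul, h1, hθ, sub_self]
  refine ⟨LinearMap.codRestrict _ ρ₀ hρ₀, ?_⟩
  refine LinearMap.ext fun k => Subtype.ext ?_
  have hθk : θ k = 0 := by
    apply hβ
    rw [hθ, map_zero, (LinearMap.mem_ker).mp k.2, smul_zero]
  simp [ρ₀, hθk]

/-- **Extension after scaling.** In the situation of `exists_linearMap_comp_kerSubtype_eq_smul`, every
functional `κ` on `ker π` extends to `F` after scaling: `∃ l : F → T` linear with `l|_{ker π} = s • κ`.
[folklore] -/
theorem exists_dual_comp_kerSubtype_eq_smul (π : F →ₗ[T] Y) (hπ : Surjective π)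
    (β : G →ₗ[T] Y) (hβ : Injective β) (s : T) (hs : ∀ y, s • y ∈ LinearMap.range β)
    (κ : Dual T (LinearMap.ker π)) :
    ∃ l : Dual T F, l ∘ₗ (LinearMap.ker π).subtype = s • κ := by
  obtain ⟨ρ, hρ⟩ := exists_linearMap_comp_kerSubtype_eq_smul π hπ β hβ s hs
  refine ⟨κ ∘ₗ ρ, ?_⟩
  rw [LinearMap.comp_assoc, hρ, LinearMap.comp_smul, LinearMap.comp_id]

end SplitAfterScaling

/-! ## 2. Torsion-free modules are free at primes with principal local ring, in `β`-form -/

section FreeAtPrime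

variable {T : Type u} [CommRing T] [IsDomain T]
variable {Y : Type v} [AddCommGroup Y] [Module T Y]

/-- **Free at `𝔭`, denominator-free form.** Let `T` be a domain, `𝔭` a prime with `T_𝔭` a principal
ideal ring (a field or a DVR), and `Y` a finitely generated torsion-free `T`-module. Then there are an
injective `β : Tⁿ ↪ Y` and `s ∉ 𝔭` with `s • Y ⊆ im β` (numerators of a `T_𝔭`-basis of `Y_𝔭`, which is
free as a finitely generated torsion-free module over a PID). [folklore] -/
theorem exists_injective_forall_smul_mem_range [Module.Finite T Y] [Module.IsTorsionFree T Y]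
    (p : Ideal T) [p.IsPrime] [IsPrincipalIdealRing (Localization.AtPrime p)] :
    ∃ (n : ℕ) (β : (Fin n → T) →ₗ[T] Y), Injective β ∧
      ∃ s : T, s ∉ p ∧ ∀ y : Y, s • y ∈ LinearMap.range β := by
  classical
  let Sp := p.primeCompl
  let Tp := Localization.AtPrime p
  let Yp := LocalizedModule Sp Y
  let f : Y →ₗ[T] Yp := LocalizedModule.mkLinearMap Sp Y
  haveI : IsDomain Tp := IsLocalization.isDomain_localization p.primeCompl_le_nonZeroDivisors
  -- a `T_𝔭`-basis of `Y_𝔭`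
  obtain ⟨n, b⟩ := Module.basisOfFiniteTypeTorsionFree' (R := Tp) (M := Yp)
  -- numerators: `b i = mk' f (y i) (t i)`; rescale to `b' i = f (y i)`
  have hsurj := IsLocalizedModule.mk'_surjective Sp f
  choose yt hyt using fun i => hsurj (b i)
  let y : Fin n → Y := fun i => (yt i).1
  let t : Fin n → Sp := fun i => (yt i).2
  have hb : ∀ i, (t i : T) • b i = f (y i) := by
    intro i
    have : IsLocalizedModule.mk' f (y i) (t i) = b i := hyt i
    rw [← this]
    exact IsLocalizedModule.mk'_cancel' f (y i) (t i)
  have hunit : ∀ i, IsUnit (algebraMap T Tp (t i)) := fun i => IsLocalization.map_units Tp (t i)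
  let b' : Module.Basis (Fin n) Tp Yp := b.isUnitSMul hunit
  have hb' : ∀ i, b' i = f (y i) := by
    intro i
    rw [Module.Basis.isUnitSMul_apply, algebraMap_smul, hb]
  -- `β := Σ aᵢ yᵢ`
  let β : (Fin n → T) →ₗ[T] Y := Fintype.linearCombination T y
  have hfβ : ∀ a : Fin n → T, f (β a) = ∑ i, algebraMap T Tp (a i) • b' i := by
    intro a
    simp only [β, Fintype.linearCombination_apply, map_sum, map_smul, hb', algebraMap_smul]
  refine ⟨n, β, ?_, ?_⟩
  · -- injective: apply `f` and use linear independence of `b'`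
    intro a₁ a₂ h
    have h' : ∑ i, algebraMap T Tp (a₁ i - a₂ i) • b' i = 0 := by
      simp only [map_sub, sub_smul, Finset.sum_sub_distrib, ← hfβ, h, sub_self]
    have hli := Fintype.linearIndependent_iff.mp b'.linearIndependent (fun i => algebraMap T Tp (a₁ i - a₂ i)) h'
    funext i
    have := hli i
    rw [← map_zero (algebraMap T Tp)] at this
    exact sub_eq_zero.mp (IsLocalization.injective Tp p.primeCompl_le_nonZeroDivisors this)
  · -- cover: every `y` has `u • y ∈ im β` for some `u ∉ 𝔭`; then a common `s` for generators
    have hone : ∀ z : Y, ∃ u : Sp, (u : T) • z ∈ LinearMap.range β := by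
      intro z
      let c : Fin n → Tp := fun i => b'.repr (f z) i
      obtain ⟨u, hu⟩ := IsLocalization.exist_integer_multiples_of_finite Sp c
      have hu' : ∀ i, ∃ a : T, algebraMap T Tp a = (u : T) • c i := fun i => hu i
      choose a ha using hu'
      have hz : f z = ∑ i, c i • b' i := by
        rw [← b'.sum_repr (f z)]
      have h1 : f ((u : T) • z) = f (β a) := by
        rw [map_smul, hz, Finset.smul_sum, hfβ]
        refine Finset.sum_congr rfl fun i _ => ?_
        rw [ha i, smul_assoc]
      obtain ⟨w, hw⟩ := (IsLocalizedModule.eq_iff_exists Sp f).mp h1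
      -- `w • (u • z) = w • β a`, torsion-free ⇒ `u • z = β a`? only `w u • z ∈ im β`:
      refine ⟨w * u, ?_⟩
      rw [Submonoid.coe_mul, mul_smul]
      change (w : T) • ((u : T) • z) ∈ LinearMap.range β
      rw [show (w : T) • ((u : T) • z) = w • ((u : T) • z) from rfl, hw, show w • β a = (w : T) • β a
        from rfl, ← map_smul]
      exact LinearMap.mem_range_self β _
    obtain ⟨m, g, hg⟩ := Module.Finite.exists_fin (R := T) (M := Y)
    choose u hu using fun j => hone (g j)
    refine ⟨∏ j, (u j : T), ?_, ?_⟩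
    · have : (∏ j, (u j : T)) ∈ Sp := by
        have := Submonoid.prod_mem Sp (fun j (_ : j ∈ Finset.univ) => (u j).2)
        simpa using this
      exact this
    · intro z
      have hz : z ∈ Submodule.span T (Set.range g) := by rw [hg]; exact Submodule.mem_top
      -- the set of `z` with `s • z ∈ im β` is a submodule containing the generators
      let N : Submodule T Y := (LinearMap.range β).comap ((∏ j, (u j : T)) • LinearMap.id)
      have hN : Submodule.span T (Set.range g) ≤ N := by
        rw [Submodule.span_le]
        rintro _ ⟨j, rfl⟩
        change (∏ k, (u k : T)) • g j ∈ LinearMap.range β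
        rw [← Finset.prod_erase_mul Finset.univ (fun k => (u k : T)) (Finset.mem_univ j), mul_smul]
        exact Submodule.smul_mem _ _ (hu j)
      exact hN hz

end FreeAtPrime

/-! ## 3. The main theorem -/

section Main

variable {T : Type u} [CommRing T] [IsDomain T] [IsNoetherianRing T] [IsLocalRing T]
  [IsIntegrallyClosed T]

omit [IsNoetherianRing T] [IsIntegrallyClosed T] in
/-- In a two-dimensional local domain, a prime other than `𝔪` and `⊥` has height one. [folklore] -/
theorem height_eq_one_of_ne_of_ne_bot (hdim : ringKrullDim T = 2) {p : Ideal T} [p.IsPrime]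
    (hp : p ≠ maximalIdeal T) (hp0 : p ≠ ⊥) : p.height = 1 := by
  have h2 : (maximalIdeal T).height = 2 := by
    have h := IsLocalRing.maximalIdeal_height_eq_ringKrullDim (R := T)
    rw [hdim] at h
    exact (WithBot.coe_eq_ofNat 2 _).mp h
  have hlt : p < maximalIdeal T :=
    lt_of_le_of_ne (IsLocalRing.le_maximalIdeal (Ideal.IsPrime.ne_top ‹_›)) hp
  have h := Ideal.height_add_one_le_of_lt_of_isPrime hlt
  rw [h2] at h
  have h0 : p.height ≠ 0 := fun h0 => hp0 (Ideal.height_eq_zero_iff_eq_bot.mp h0)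
  have htop : p.height ≠ ⊤ := by
    intro ht
    rw [ht] at h
    exact absurd h (by decide)
  obtain ⟨k, hk⟩ := ENat.ne_top_iff_exists.mp htop
  rw [← hk] at h h0 ⊢
  norm_cast at h h0 ⊢
  omega

omit [IsDomain T] [IsNoetherianRing T] [IsIntegrallyClosed T] in
/-- `ht 𝔪 > 1` from `ringKrullDim T = 2`. [folklore] -/
theorem not_height_maximalIdeal_le_one (hdim : ringKrullDim T = 2) :
    ¬ (maximalIdeal T).height ≤ 1 := by
  have h2 : (maximalIdeal T).height = 2 := by
    have h := IsLocalRing.maximalIdeal_height_eq_ringKrullDim (R := T)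
    rw [hdim] at h
    exact (WithBot.coe_eq_ofNat 2 _).mp h
  rw [h2]
  decide


/-- **CA2 = [Iyama–Wemyss 2.7 (e)⇒(d)] without completeness.** Let `T` be a noetherian local normal
domain with `ringKrullDim T = 2`, `X` a finitely generated reflexive `T`-module, and
`0 → X* → P → Y → 0` exact (`S` with `S.X₁ ≅ X*`) with `P` finitely generated free and `Y` finitely
generated reflexive («`X* ∈ ΩCM`»). Then `Ext¹_T(X, T) = 0`. Signature = res-L0-w44-plan-1's typed target
(`SketchCALayer.lean`) = the consumer shape of `exists_extVanishingInput_dual_of_isSyzygy`.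
[cite: IyamaWemyss2009, Thm. 2.7 (e)⇒(d); folklore] -/
theorem ext_one_eq_zero_of_dual_syzygy_of_reflexive (hdim : ringKrullDim T = 2)
    (X : ModuleCat.{u} T) [Module.Finite T X] (hX : Module.IsReflexive T X)
    (S : ShortComplex (ModuleCat.{u} T)) (hS : S.ShortExact)
    (e₁ : S.X₁ ≅ ModuleCat.of T (Module.Dual T X))
    [Module.Finite T S.X₂] [Module.Free T S.X₂] [Module.Finite T S.X₃]
    (hY : Module.IsReflexive T S.X₃)
    (e : Ext.{u} X (ModuleCat.of T T) 1) : e = 0 := by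
  classical
  haveI := hX
  haveI := hY
  have hT : ¬ (maximalIdeal T).height ≤ 1 := not_height_maximalIdeal_le_one hdim
  /- the maps `j : X* ↪ P`, `π : P ↠ Y`, `im j = ker π` -/
  let ε : Dual T X ≃ₗ[T] S.X₁ := e₁.toLinearEquiv.symm
  let j : Dual T X →ₗ[T] S.X₂ := S.f.hom ∘ₗ ε.toLinearMap
  let π : S.X₂ →ₗ[T] S.X₃ := S.g.hom
  have hπ : Surjective π := hS.moduleCat_surjective_g
  have hj : Injective j := hS.moduleCat_injective_f.comp ε.injective
  have hrange : LinearMap.range j = LinearMap.ker π := by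
    rw [LinearMap.range_comp_of_range_eq_top _ ε.range]
    exact hS.exact.moduleCat_range_eq_ker
  let K : Submodule T S.X₂ := LinearMap.ker π
  let εK : Dual T X ≃ₗ[T] K := LinearEquiv.ofInjective j hj ≪≫ₗ LinearEquiv.ofEq _ _ hrange
  have hεK : ∀ φ : Dual T X, (εK φ : S.X₂) = j φ := fun φ => rfl
  /- duals: `πd : Y* ↪ P*`, `jd : P* → X**`, `B := im jd`, `E₁ := X** / B` -/
  let πd : Dual T S.X₃ →ₗ[T] Dual T S.X₂ := π.dualMap
  let jd : Dual T S.X₂ →ₗ[T] Dual T (Dual T X) := j.dualMap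
  let B : Submodule T (Dual T (Dual T X)) := LinearMap.range jd
  have hπd : Injective πd := LinearMap.dualMap_injective_of_surjective hπ
  have hker : LinearMap.ker jd = LinearMap.range πd := by
    rw [LinearMap.range_dualMap_eq_dualAnnihilator_ker_of_surjective π hπ, ← hrange]
    ext φ
    simp only [LinearMap.mem_ker, Submodule.mem_dualAnnihilator]
    constructor
    · rintro h _ ⟨x, rfl⟩
      exact LinearMap.congr_fun h x
    · intro h
      ext x
      exact h _ ⟨x, rfl⟩
  -- membership in `B` from an extension after scaling
  have hB_of : ∀ (ψ : Dual T (Dual T X)) (c : T) (l : Dual T S.X₂),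
      l ∘ₗ K.subtype = c • (ψ ∘ₗ εK.symm.toLinearMap) → c • ψ ∈ B := by
    intro ψ c l hl
    refine ⟨l, ?_⟩
    ext φ
    have h1 := LinearMap.congr_fun hl (εK φ)
    simp only [LinearMap.coe_comp, Function.comp_apply, Submodule.subtype_apply, LinearMap.smul_apply,
      LinearEquiv.coe_coe, LinearEquiv.symm_apply_apply] at h1
    rw [hεK] at h1
    simpa [jd, LinearMap.dualMap_apply] using h1
  /- the two short exact sequences -/
  let jdB : Dual T S.X₂ →ₗ[T] B := jd.rangeRestrict
  have hcomp₂ : jdB ∘ₗ πd = 0 := by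
    refine LinearMap.ext fun μ => Subtype.ext ?_
    have : πd μ ∈ LinearMap.ker jd := hker ▸ ⟨μ, rfl⟩
    simpa [jdB] using this
  let S₂ := ModuleCat.shortComplexOfCompEqZero (L := ↥B) πd jdB (by exact hcomp₂)
  have hS₂ : S₂.ShortExact :=
    ModuleCat.shortComplex_shortExact S₂
      (LinearMap.exact_iff.mpr (by
        change LinearMap.ker jdB = LinearMap.range πd
        rw [LinearMap.ker_rangeRestrict, hker]))
      hπd (LinearMap.surjective_rangeRestrict jd)
  have hcomp₁ : B.mkQ ∘ₗ B.subtype = 0 := by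
    ext x
    simp
  let S₁ := ModuleCat.shortComplexOfCompEqZero (M := ↥B) B.subtype B.mkQ (by exact hcomp₁)
  have hS₁ : S₁.ShortExact :=
    ModuleCat.shortComplex_shortExact S₁ (LinearMap.exact_subtype_mkQ B) B.injective_subtype
      (Submodule.mkQ_surjective B)
  /- (a) `Ext¹(B, T) = 0` -/
  have hB0 : ∀ e' : Ext S₂.X₃ (ModuleCat.of T T) 1, e' = 0 := by
    intro e'
    haveI : Projective S₂.X₂ := (IsProjective.iff_projective (R := T) (Dual T S.X₂)).mp inferInstance
    obtain ⟨x, hx⟩ := precomp_extClass_surjective_of_projective_X₂ (ModuleCat.of T T) hS₂ 0 e'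
    obtain ⟨φ, rfl⟩ : ∃ φ : S₂.X₁ ⟶ ModuleCat.of T T, Ext.mk₀ φ = x :=
      ⟨Ext.homEquiv₀ x, Ext.mk₀_homEquiv₀_apply x⟩
    -- `φ ∈ Y** = ev(Y)`, `Y = π(P)`
    obtain ⟨y, hy⟩ := (Module.bijective_dual_eval T S.X₃).2 φ.hom
    obtain ⟨q, rfl⟩ := hπ y
    have hφ : φ = S₂.f ≫ ModuleCat.ofHom (Module.Dual.eval T S.X₂ q) := by
      ext μ
      change φ.hom μ = Module.Dual.eval T S.X₂ q (πd μ)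
      rw [← hy]
      rfl
    rw [hφ, ← Ext.mk₀_comp_mk₀] at hx
    rw [← hx]
    exact hS₂.extClass_comp_assoc (h := add_comm 1 0) _
  /- (b) `E₁` is supported on `{𝔪}` -/
  haveI : Module.Finite T (Dual T X) := finite_dual X
  haveI : Module.Finite T (Dual T (Dual T X)) := finite_dual (Dual T X)
  have hsupp : Module.support T (Dual T (Dual T X) ⧸ B) ⊆ PrimeSpectrum.zeroLocus (maximalIdeal T) := by
    intro q hq
    rw [PrimeSpectrum.mem_zeroLocus]
    by_contra hne
    have hq' : q.asIdeal ≠ maximalIdeal T := fun h => hne (by rw [h])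
    -- every `ψ ∈ X**` is killed into `B` by some `s ∉ q`
    have hkill : ∀ ψ : Dual T (Dual T X), ∃ s : T, s ∉ q.asIdeal ∧ s • ψ ∈ B := by
      by_cases hq0 : q.asIdeal = ⊥
      · intro ψ
        obtain ⟨d, hd, l, hl⟩ :=
          exists_dual_comp_subtype_eq_smul_of_free K (ψ ∘ₗ εK.symm.toLinearMap)
        exact ⟨d, by rw [hq0]; simpa using hd, hB_of ψ d l hl⟩
      · haveI := q.2
        have h1 : q.asIdeal.height = 1 := height_eq_one_of_ne_of_ne_bot hdim hq' hq0
        haveI : IsDiscreteValuationRing (Localization.AtPrime q.asIdeal) :=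
          Literature.AlgebraicGeometry.Resolution.isDiscreteValuationRing_localization_of_height_eq_one
            q.asIdeal h1
        obtain ⟨n, β, hβ, s, hs, hsβ⟩ :=
          exists_injective_forall_smul_mem_range (Y := S.X₃) q.asIdeal
        intro ψ
        obtain ⟨l, hl⟩ :=
          exists_dual_comp_kerSubtype_eq_smul π hπ β hβ s hsβ (ψ ∘ₗ εK.symm.toLinearMap)
        exact ⟨s, hs, hB_of ψ s l hl⟩
    refine (Module.notMem_support_iff'.mpr fun m => ?_) hq
    obtain ⟨ψ, rfl⟩ := Submodule.Quotient.mk_surjective B m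
    obtain ⟨s, hs, hsB⟩ := hkill ψ
    exact ⟨s, hs, by rw [← Submodule.Quotient.mk_smul, (Submodule.Quotient.mk_eq_zero B).mpr hsB]⟩
  /- (c) `Ext¹(E₁, T) = 0` by grade, then the long exact sequence of `S₁`, then `X ≅ X**` -/
  haveI : Subsingleton (Ext S₁.X₃ (ModuleCat.of T T) 1) :=
    subsingleton_ext_of_support_subset hT S₁.X₃ hsupp 1 one_lt_two
  have hXDD : ∀ e₂ : Ext S₁.X₂ (ModuleCat.of T T) 1, e₂ = 0 := by
    intro e₂
    have h1 : (Ext.mk₀ S₁.f).comp e₂ (zero_add 1) = 0 := hB0 _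
    obtain ⟨x₃, hx₃⟩ := Ext.contravariant_sequence_exact₂ hS₁ (ModuleCat.of T T) e₂ h1
    rw [← hx₃, Subsingleton.elim x₃ 0, Ext.comp_zero]
  let ι : X ≅ S₁.X₂ := (Module.evalEquiv T X).toModuleIso
  have he : e = (Ext.mk₀ ι.hom).comp ((Ext.mk₀ ι.inv).comp e (zero_add 1)) (zero_add 1) := by
    rw [Ext.mk₀_comp_mk₀_assoc, Iso.hom_inv_id, Ext.mk₀_id_comp]
  rw [he, hXDD ((Ext.mk₀ ι.inv).comp e (zero_add 1)), Ext.comp_zero]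

end Main

end Summit.ResolutionOfSingularities.ResolutionOfSingularities.Theorems.NoZeno.SandwichCluster

end
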